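import Summits.QuantumFields.YangMills.Theorems.ParabolicTrajectoryContinuumLimitOnTrajectoryDefsC
import Summits.QuantumFields.YangMills.Theorems.ParabolicTrajectoryContinuumLimitOnTrajectoryStubOSLegsA_Lattice
import Literature.MathematicalPhysics.QuantumFieldTheory.WilsonAxisSymmetry

/-!
# Stub `stub_axisSymmetry : AxisSymmetry` (line `two-orbit-synchronisation`, crux stmt-QuantumFields-10522, skeleton v3.1, seat c2) — PROVED

Exact HYPERCUBIC (axis-permutation) symmetry of the canonical curvature distributions
`curvDistribution r sch k p F = ∑_{x ∈ (box 4 L_k)^p} F(a_k x⃗) ∫ ∏ᵢ cw(xᵢ)(U) dμ_k` (`curvDistribution_eq_sum`):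
for every permutation `σ` of the four axes,
`curvDistribution r sch k p (linActMulti (piLpCongrLeft 2 ℝ ℝ σ) F) = curvDistribution r sch k p F`.

Proof (all lattice kinematics from the tree):
* `(piLpCongrLeft 2 ℝ ℝ σ)⁻¹ (a • x) = a • (sitePermZd σ⁻¹ x)` (`piLpCongrLeft_symm_smul_siteToE`), and the
  cube `box 4 L_k` of representatives is invariant under `sitePermZd` (`sitePermZd_mem_box_iff`), so the finite
  sum over `(box 4 L_k)^p` is re-indexed by the permutation of the axes;
* the centred curvature weight at the permuted point of the permuted torus configuration is the weight at the
  point, `cw (π y) (configPerm π U) = cw y U` (`cw_sitePermZd_configPerm`): the periodic lift intertwines the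
  permutations of the torus and of `ℤ⁴`, `configPermZd π` conjugates `τ_y` to `τ_{π y}`, and the action density
  `∑_{μ<ν} Re tr r.ρ(U_{0,μν})` is invariant (the six planes are permuted; a reversed orientation inverts the
  holonomy and `Re tr ρ(h⁻¹) = Re tr ρ(h)` for the continuous representation `r.ρ` of the compact `G`) —
  `LatticeRep.curvature_F_perm_torusLift` of `Literature/…/WilsonAxisSymmetry.lean`; the centring constant
  `wilsonTorusMean` does not see the point;
* Wilson's torus measure is invariant under `configPerm π` (tree `wilsonMeasure_map_configPerm`: product Haar
  measure is invariant under relabelling the links, the Wilson action under permuting the plaquettes), so the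
  joint moments `∫ ∏ᵢ cw(yᵢ) dμ_k` are invariant under `y ↦ π ∘ y` (`integral_prod_cw_sitePermZd`).
Refs: K. Wilson, Phys. Rev. D 10 (1974) 2445; E. Seiler, LNP 159 (1982) Ch. 1.
-/

set_option autoImplicit false

open scoped SchwartzMap
open MeasureTheory Filter Topology
open Literature.MathematicalPhysics.QuantumFieldTheory Literature.MathematicalPhysics.QuantumLattice
open Literature.MathematicalPhysics.AQFT Literature.Probability.LatticeModels
open Summit.QuantumFields.YangMills.Theses.ParabolicTrajectory

noncomputable section

namespace Summit.QuantumFields.YangMills.Cruxes.ContinuumLimitOnTrajectory.TwoOrbitSynchronisation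

local notation "𝔼" => EuclideanSpace ℝ (Fin 4)

section AxisSymmetry

variable {G : Type} [Group G] [TopologicalSpace G] [IsTopologicalGroup G] [CompactSpace G]
  [MeasurableSpace G] [BorelSpace G]

/-- **The centred curvature weight at the permuted point of the permuted configuration is the weight at
the point**: `cw (π y) (configPerm π U) = cw y U` (`LatticeRep.curvature_F_perm_torusLift`; the centring
constant `wilsonTorusMean` does not see the point). -/
theorem cw_sitePermZd_configPerm (r : LatticeRep G) (sch : SpeciesScheme (YMSpecies G)) (k : ℕ)
    (π : Equiv.Perm (Fin 4)) (y : Site 4) (U : GaugeConfig 4 (sch.side k) G) :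
    cw r sch k (sitePermZd π y) (configPerm π U) = cw r sch k y U := by
  unfold cw
  rw [LatticeRep.curvature_F_perm_torusLift]

/-- **Joint moments of the curvature weights are invariant under permutations of the axes**: change
variables `U ↦ configPerm π U` in Wilson's torus measure (`integral_comp_configPerm_wilsonMeasure`). -/
theorem integral_prod_cw_sitePermZd (r : LatticeRep G) (sch : SpeciesScheme (YMSpecies G)) (k p : ℕ)
    (π : Equiv.Perm (Fin 4)) (y : Fin p → Site 4) :
    ∫ U, ∏ i, ((cw r sch k (sitePermZd π (y i)) U : ℝ) : ℂ) ∂(μW r sch k) =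
      ∫ U, ∏ i, ((cw r sch k (y i) U : ℝ) : ℂ) ∂(μW r sch k) := by
  rw [← integral_comp_configPerm_wilsonMeasure r.ρ r.continuous (sch.β k) π
    (fun U => ∏ i, ((cw r sch k (sitePermZd π (y i)) U : ℝ) : ℂ))]
  simp only [cw_sitePermZd_configPerm]

/-- **Exact axis symmetry of the canonical curvature distributions** (lattice form of `AxisSymm`):
permuting the coordinates of all points of the test function by `piLpCongrLeft 2 ℝ ℝ σ` leaves
`curvDistribution r sch k p` unchanged — re-index the finite sum over `(box 4 L_k)^p` by the permutation of
the axes (the cube is invariant) and use the invariance of the joint moments of the curvature weights. -/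
theorem curvDistribution_linActMulti_piLpCongrLeft (r : LatticeRep G) (sch : SpeciesScheme (YMSpecies G))
    (k p : ℕ) (σ : Equiv.Perm (Fin 4)) (F : 𝓢((Fin p → 𝔼), ℂ)) :
    curvDistribution r sch k p (linActMulti (LinearIsometryEquiv.piLpCongrLeft 2 ℝ ℝ σ) F) =
      curvDistribution r sch k p F := by
  rw [curvDistribution_eq_sum, curvDistribution_eq_sum]
  -- the permutation of the axes as a bijection of the cube of representatives
  let e : ↥(box 4 (sch.L k)) ≃ ↥(box 4 (sch.L k)) :=
    (sitePermZd σ.symm).subtypeEquiv fun x => (sitePermZd_mem_box_iff σ.symm (sch.L k) x).symm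
  have he : ∀ z : ↥(box 4 (sch.L k)), ((e z : ↥(box 4 (sch.L k))) : Site 4) = sitePermZd σ.symm (z : Site 4) :=
    fun z => rfl
  refine Fintype.sum_equiv (Equiv.piCongrRight fun _ : Fin p => e) _ _ fun x => ?_
  simp only [linActMulti_apply, piLpCongrLeft_symm_smul_siteToE, Equiv.piCongrRight_apply, Pi.map_apply,
    he]
  rw [integral_prod_cw_sitePermZd r sch k p σ.symm (fun i => (x i : Site 4))]

end AxisSymmetry

/-- **Registered stub `stub_axisSymmetry` — exact axis symmetry (PROVED lattice kinematics)**: for every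
compact `G`, every lattice representation `r` and every scheme `sch`, the canonical curvature distributions
are invariant under permutations of the four lattice axes (`curvDistribution_linActMulti_piLpCongrLeft`). -/
theorem stub_axisSymmetry : AxisSymmetry := by
  intro G _ _ _ _ _ _ r sch k p σ F
  exact curvDistribution_linActMulti_piLpCongrLeft r sch k p σ F

end Summit.QuantumFields.YangMills.Cruxes.ContinuumLimitOnTrajectory.TwoOrbitSynchronisation

end
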